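import Summits.HubbardSuperconductivity.HubbardSuperconductivity.Theorems.BalabanIRBirEveryGroundStateSchur
import Literature.MathematicalPhysics.QuantumLattice.HubbardRingGroundStateContinuityProofs

/-!
# Route `BalabanIR`, crux 5 `BirEveryGroundState` (item `stmt-HubbardSuperconductivity-2083`):
# an affine stretch of the sector ground energy forces joint eigenvectors

The lemma `AffineGroundForcesJointEigen` of the crux card
`Cruxes/BirEveryGroundState/Ideas/integer-pencil-schur-residue.md` (the tool behind its "T/U
dichotomy" refinement of the residue `DarkPartnerExclusion`): the sector ground energy
`e(U) = minEnergyOn (T + U D) K` of an affine Hermitian pencil is concave in `U` (a minimum of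
affine functions), and if it is NOT strictly concave at `U₀` at scale `η` — midpoint equality
`2 e(U₀) = e(U₀ - η) + e(U₀ + η)`, e.g. `e` affine on `[U₀ - η, U₀ + η]` — then EVERY ground vector
of the midpoint Hamiltonian in `K` is a ground vector at both endpoints
(`groundState_endpoints_of_midpoint`, stated for any three Hermitian `K`-preserving matrices with
`H₋ + H₊ = H₀ + H₀`), hence a JOINT eigenvector of `T` and `D` (`pencil_jointEigen_of_midpoint`).
For the Hubbard Hamiltonian `hamiltonian G t U = hamiltonian G t 0 + U · Σ_x n_{x↑} n_{x↓}` on any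
finite graph (`hamiltonian_eq_add_smul_doublon`) this reads: on a `U`-window where the
`(2m, S^z = 0)`-sector ground energy is affine, every sector ground state is a simultaneous
eigenvector of the hopping matrix and of the double-occupancy number
(`hubbard_jointEigen_of_midpoint`) — the "T/U states" of Bruus–Anglès d'Auriac (1997) are the
only candidates for a ground branch along which `U ↦ e(U)` is straight.
Proof: variational principle at the endpoints, `e(U₀ ± η) ‖ψ‖² ≤ ⟨ψ, H(U₀ ± η) ψ⟩`, summed and
compared with `2 ⟨ψ, H(U₀) ψ⟩ = 2 e(U₀) ‖ψ‖² ≤ (e(U₀ - η) + e(U₀ + η)) ‖ψ‖²`, forces equality in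
both, and equality in the variational principle on an invariant subspace is the eigen-equation
(`mulVec_eq_smul_of_forall_le_on`). Tasaki (2020) §2.1; Lieb–Wu, Physica A 321 (2003) §2;
Bruus–Anglès d'Auriac, PRB 55 (1997) 9142, §5.2. Everything is folklore; no definition is
introduced.
-/

noncomputable section

namespace Summit.HubbardSuperconductivity.HubbardSuperconductivity.Theorems

open Matrix Finset
open Literature.MathematicalPhysics.QuantumLattice
open Literature.MathematicalPhysics.QuantumLattice.EigenvalueContinuation
open scoped ComplexOrder

/-! ### The variational core -/

section Variational

variable {n : Type*} [Fintype n]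

/-- **Homogeneous variational principle in a sector**: `minEnergyOn A K · ‖v‖² ≤ re ⟨v, A v⟩` for
every `v ∈ K` (normalise `v ≠ 0` and use `minEnergyOn_le_re_rayleigh`). Tasaki (2020) §2.1,
(2.1.6). [folklore] -/
theorem minEnergyOn_mul_re_le (A : Matrix n n ℂ) (K : Submodule ℂ (n → ℂ)) {v : n → ℂ}
    (hv : v ∈ K) : A.minEnergyOn K * (star v ⬝ᵥ v).re ≤ (star v ⬝ᵥ A *ᵥ v).re := by
  by_cases h0 : v = 0
  · subst h0
    simp
  obtain ⟨c, -, hcc, hunit⟩ := exists_normalize h0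
  have hmem : (c : ℂ) • v ∈ K := K.smul_mem _ hv
  have h1 := minEnergyOn_le_re_rayleigh A K hmem hunit
  rw [mulVec_smul, star_real_smul_dotProduct_real_smul, Complex.re_ofReal_mul] at h1
  have hvv : 0 ≤ (star v ⬝ᵥ v).re := re_star_dotProduct_self_nonneg v
  calc A.minEnergyOn K * (star v ⬝ᵥ v).re
      ≤ (c * c * (star v ⬝ᵥ A *ᵥ v).re) * (star v ⬝ᵥ v).re := mul_le_mul_of_nonneg_right h1 hvv
    _ = (star v ⬝ᵥ A *ᵥ v).re * (c * c * (star v ⬝ᵥ v).re) := by ring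
    _ = (star v ⬝ᵥ A *ᵥ v).re := by rw [hcc, mul_one]

/-- **Midpoint equality of sector ground energies propagates ground states to the endpoints.**
Let `H₋, H₊` be Hermitian matrices preserving the subspace `K`, and `H₀` with
`H₋ + H₊ = H₀ + H₀` (e.g. three equally spaced members of an affine pencil). The sector energy is
midpoint-concave, `e₋ + e₊ ≤ 2 e₀` (`eⱼ = minEnergyOn Hⱼ K`); if EQUALITY holds (hypothesis
`2 e₀ ≤ e₋ + e₊`), then every ground vector of `H₀` in `K` — `ψ ∈ K`, `H₀ ψ = e₀ ψ` — is a
ground vector of `H₋` and of `H₊`: `H₋ ψ = e₋ ψ`, `H₊ ψ = e₊ ψ`. (Variational principle at the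
endpoints, summed: `(e₋ + e₊) ‖ψ‖² ≤ ⟨ψ, H₋ ψ⟩ + ⟨ψ, H₊ ψ⟩ = 2 e₀ ‖ψ‖² ≤ (e₋ + e₊) ‖ψ‖²`, so both
are equalities; equality case `mulVec_eq_smul_of_forall_le_on`.) Tasaki (2020) §2.1; Lieb–Wu,
Physica A 321 (2003) §2. [folklore] -/
theorem groundState_endpoints_of_midpoint (K : Submodule ℂ (n → ℂ)) {Hm H0 Hp : Matrix n n ℂ}
    (hHm : Hmᴴ = Hm) (hHp : Hpᴴ = Hp) (hKm : ∀ v ∈ K, Hm *ᵥ v ∈ K) (hKp : ∀ v ∈ K, Hp *ᵥ v ∈ K)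
    (hsum : Hm + Hp = H0 + H0)
    (hmid : 2 * H0.minEnergyOn K ≤ Hm.minEnergyOn K + Hp.minEnergyOn K)
    {ψ : n → ℂ} (hψK : ψ ∈ K) (hgs : H0 *ᵥ ψ = ((H0.minEnergyOn K : ℝ) : ℂ) • ψ) :
    Hm *ᵥ ψ = ((Hm.minEnergyOn K : ℝ) : ℂ) • ψ ∧ Hp *ᵥ ψ = ((Hp.minEnergyOn K : ℝ) : ℂ) • ψ := by
  have hvm : ∀ v ∈ K, Hm.minEnergyOn K * (star v ⬝ᵥ v).re ≤ (star v ⬝ᵥ Hm *ᵥ v).re :=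
    fun v hv => minEnergyOn_mul_re_le Hm K hv
  have hvp : ∀ v ∈ K, Hp.minEnergyOn K * (star v ⬝ᵥ v).re ≤ (star v ⬝ᵥ Hp *ᵥ v).re :=
    fun v hv => minEnergyOn_mul_re_le Hp K hv
  -- the energies of `ψ`
  have h0 : (star ψ ⬝ᵥ H0 *ᵥ ψ).re = H0.minEnergyOn K * (star ψ ⬝ᵥ ψ).re :=
    re_star_dotProduct_mulVec_of_eigen hgs
  have haddC : star ψ ⬝ᵥ Hm *ᵥ ψ + star ψ ⬝ᵥ Hp *ᵥ ψ =
      star ψ ⬝ᵥ H0 *ᵥ ψ + star ψ ⬝ᵥ H0 *ᵥ ψ := by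
    rw [← dotProduct_add, ← add_mulVec, hsum, add_mulVec, dotProduct_add]
  have hadd : (star ψ ⬝ᵥ Hm *ᵥ ψ).re + (star ψ ⬝ᵥ Hp *ᵥ ψ).re =
      2 * (H0.minEnergyOn K * (star ψ ⬝ᵥ ψ).re) := by
    have := congrArg Complex.re haddC
    rw [Complex.add_re, Complex.add_re, h0] at this
    linarith
  have hψψ : 0 ≤ (star ψ ⬝ᵥ ψ).re := re_star_dotProduct_self_nonneg ψ
  have hm' := hvm ψ hψK
  have hp' := hvp ψ hψK
  have hmid' : 2 * (H0.minEnergyOn K * (star ψ ⬝ᵥ ψ).re) ≤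
      (Hm.minEnergyOn K + Hp.minEnergyOn K) * (star ψ ⬝ᵥ ψ).re := by
    have := mul_le_mul_of_nonneg_right hmid hψψ
    linarith [this]
  have hle_m : (star ψ ⬝ᵥ Hm *ᵥ ψ).re ≤ Hm.minEnergyOn K * (star ψ ⬝ᵥ ψ).re := by nlinarith
  have hle_p : (star ψ ⬝ᵥ Hp *ᵥ ψ).re ≤ Hp.minEnergyOn K * (star ψ ⬝ᵥ ψ).re := by nlinarith
  exact ⟨mulVec_eq_smul_of_forall_le_on hHm K hKm hvm hψK hle_m,
    mulVec_eq_smul_of_forall_le_on hHp K hKp hvp hψK hle_p⟩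

/-- **Affine pencil: a straight stretch of the sector ground energy forces joint eigenvectors**
(card `integer-pencil-schur-residue`, lemma `AffineGroundForcesJointEigen`). Let `T`, `D` be
Hermitian and preserve `K`, `H(U) = T + U D`, `e(U) = minEnergyOn (H U) K` (concave in `U`). If
`2 e(U₀) ≤ e(U₀ - η) + e(U₀ + η)` for some `η ≠ 0` (midpoint equality; automatic when `e` is
affine on `[U₀ - η, U₀ + η]`), then every ground vector `ψ ∈ K` of `H(U₀)` is a joint eigenvector:
`D ψ = β ψ` and `T ψ = (e(U₀ + η) - (U₀ + η) β) ψ` with `β = (e(U₀ + η) - e(U₀ - η)) / (2η)`.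
(By `groundState_endpoints_of_midpoint`, `ψ` is a ground vector of `H(U₀ ± η)`; subtract and
add the two eigen-equations.) Bruus–Anglès d'Auriac, PRB 55 (1997) 9142, §5.2 ("T/U states");
Tasaki (2020) §2.1. [folklore] -/
theorem pencil_jointEigen_of_midpoint (K : Submodule ℂ (n → ℂ)) {T D : Matrix n n ℂ}
    (hT : Tᴴ = T) (hD : Dᴴ = D) (hTK : ∀ v ∈ K, T *ᵥ v ∈ K) (hDK : ∀ v ∈ K, D *ᵥ v ∈ K)
    (U₀ η : ℝ) (hη : η ≠ 0)
    (hmid : 2 * (T + (U₀ : ℂ) • D).minEnergyOn K ≤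
      (T + ((U₀ - η : ℝ) : ℂ) • D).minEnergyOn K + (T + ((U₀ + η : ℝ) : ℂ) • D).minEnergyOn K)
    {ψ : n → ℂ} (hψK : ψ ∈ K)
    (hgs : (T + (U₀ : ℂ) • D) *ᵥ ψ = (((T + (U₀ : ℂ) • D).minEnergyOn K : ℝ) : ℂ) • ψ) :
    let β : ℝ := ((T + ((U₀ + η : ℝ) : ℂ) • D).minEnergyOn K -
      (T + ((U₀ - η : ℝ) : ℂ) • D).minEnergyOn K) / (2 * η)
    D *ᵥ ψ = (β : ℂ) • ψ ∧
      T *ᵥ ψ = (((T + ((U₀ + η : ℝ) : ℂ) • D).minEnergyOn K - (U₀ + η) * β : ℝ) : ℂ) • ψ := by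
  intro β
  -- Hermiticity and invariance of the pencil members
  have hherm : ∀ c : ℝ, (T + (c : ℂ) • D)ᴴ = T + (c : ℂ) • D := fun c => by
    rw [conjTranspose_add, conjTranspose_smul, hT, hD, Complex.star_def, Complex.conj_ofReal]
  have hinv : ∀ c : ℝ, ∀ v ∈ K, (T + (c : ℂ) • D) *ᵥ v ∈ K := fun c v hv => by
    rw [add_mulVec, smul_mulVec]
    exact K.add_mem (hTK v hv) (K.smul_mem _ (hDK v hv))
  have hsum : (T + ((U₀ - η : ℝ) : ℂ) • D) + (T + ((U₀ + η : ℝ) : ℂ) • D) =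
      (T + (U₀ : ℂ) • D) + (T + (U₀ : ℂ) • D) := by
    have hc : ((U₀ - η : ℝ) : ℂ) + ((U₀ + η : ℝ) : ℂ) = (U₀ : ℂ) + (U₀ : ℂ) := by
      push_cast
      ring
    calc (T + ((U₀ - η : ℝ) : ℂ) • D) + (T + ((U₀ + η : ℝ) : ℂ) • D)
        = (T + T) + (((U₀ - η : ℝ) : ℂ) + ((U₀ + η : ℝ) : ℂ)) • D := by rw [add_smul]; abel
      _ = (T + T) + ((U₀ : ℂ) + (U₀ : ℂ)) • D := by rw [hc]
      _ = (T + (U₀ : ℂ) • D) + (T + (U₀ : ℂ) • D) := by rw [add_smul]; abel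
  obtain ⟨hm, hp⟩ := groundState_endpoints_of_midpoint K (hherm _) (hherm _) (hinv _) (hinv _)
    hsum hmid hψK hgs
  -- subtract and add the endpoint eigen-equations
  set em : ℝ := (T + ((U₀ - η : ℝ) : ℂ) • D).minEnergyOn K with hem
  set ep : ℝ := (T + ((U₀ + η : ℝ) : ℂ) • D).minEnergyOn K with hep
  rw [add_mulVec, smul_mulVec] at hm hp
  have hsub : (((U₀ + η : ℝ) : ℂ) - ((U₀ - η : ℝ) : ℂ)) • (D *ᵥ ψ) = ((ep : ℂ) - (em : ℂ)) • ψ := by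
    rw [sub_smul, sub_smul, ← hp, ← hm]
    abel
  have h2η : ((U₀ + η : ℝ) : ℂ) - ((U₀ - η : ℝ) : ℂ) = ((2 * η : ℝ) : ℂ) := by
    push_cast
    ring
  have h2η0 : ((2 * η : ℝ) : ℂ) ≠ 0 := by
    exact_mod_cast mul_ne_zero two_ne_zero hη
  rw [h2η] at hsub
  have hDψ : D *ᵥ ψ = (β : ℂ) • ψ := by
    calc D *ᵥ ψ = ((2 * η : ℝ) : ℂ)⁻¹ • (((2 * η : ℝ) : ℂ) • (D *ᵥ ψ)) := by
          rw [inv_smul_smul₀ h2η0]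
      _ = (((2 * η : ℝ) : ℂ)⁻¹ * ((ep : ℂ) - (em : ℂ))) • ψ := by rw [hsub, smul_smul]
      _ = (β : ℂ) • ψ := by
          congr 1
          show ((2 * η : ℝ) : ℂ)⁻¹ * ((ep : ℂ) - (em : ℂ)) = (((ep - em) / (2 * η) : ℝ) : ℂ)
          push_cast
          ring
  refine ⟨hDψ, ?_⟩
  have hT' : T *ᵥ ψ = (ep : ℂ) • ψ - ((U₀ + η : ℝ) : ℂ) • (D *ᵥ ψ) := by rw [← hp]; abel
  rw [hT', hDψ, smul_smul, ← sub_smul]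
  congr 1
  push_cast
  ring

end Variational

/-! ### The Hubbard Hamiltonian as an affine pencil in `U` -/

section Hubbard

variable {Λ : Type*} [LinearOrder Λ] [Fintype Λ] (G : SimpleGraph Λ) [DecidableRel G.Adj]

/-- `H(t, U) = H(t, 0) + U · Σ_x n_{x↑} n_{x↓}`: the Hubbard Hamiltonian is an affine pencil in
the coupling, with slope the double-occupancy number. Hubbard (1963); Lieb, PRL 62 (1989) 1201.
[folklore] -/
theorem hamiltonian_eq_add_smul_doublon (t U : ℝ) :
    hamiltonian G t U = hamiltonian G t 0 + (U : ℂ) • ∑ x : Λ, numberOp x 0 * numberOp x 1 := by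
  unfold hamiltonian
  rw [Complex.ofReal_zero, zero_smul, add_zero]

/-- The double-occupancy number `Σ_x n_{x↑} n_{x↓} = H(t, 1) - H(t, 0)` is Hermitian. [folklore] -/
theorem doublon_isHermitian :
    (∑ x : Λ, numberOp x 0 * numberOp x 1 : Matrix (Finset (Orb Λ)) (Finset (Orb Λ)) ℂ)ᴴ =
      ∑ x : Λ, numberOp x 0 * numberOp x 1 := by
  have h : (∑ x : Λ, numberOp x 0 * numberOp x 1 : Matrix (Finset (Orb Λ)) (Finset (Orb Λ)) ℂ) =
      hamiltonian (⊥ : SimpleGraph Λ) 0 1 - hamiltonian (⊥ : SimpleGraph Λ) 0 0 := by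
    rw [hamiltonian_eq_add_smul_doublon ⊥ 0 1, Complex.ofReal_one, one_smul, add_sub_cancel_left]
  rw [h, conjTranspose_sub, (LiebThm1.hamiltonian_isHermitian (⊥ : SimpleGraph Λ) 0 1).eq,
    (LiebThm1.hamiltonian_isHermitian (⊥ : SimpleGraph Λ) 0 0).eq]

/-- The double-occupancy number preserves the joint sectors `(2m, S^z = 0)`. [folklore] -/
theorem doublon_mulVec_mem_szSector (m : ℕ) {v : Fock (Orb Λ)} (hv : v ∈ szSector (2 * m) 0) :
    (∑ x : Λ, numberOp x 0 * numberOp x 1) *ᵥ v ∈ szSector (2 * m) 0 := by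
  have h : (∑ x : Λ, numberOp x 0 * numberOp x 1 : Matrix (Finset (Orb Λ)) (Finset (Orb Λ)) ℂ) =
      hamiltonian (⊥ : SimpleGraph Λ) 0 1 - hamiltonian (⊥ : SimpleGraph Λ) 0 0 := by
    rw [hamiltonian_eq_add_smul_doublon ⊥ 0 1, Complex.ofReal_one, one_smul, add_sub_cancel_left]
  rw [mem_szSector_two_mul_zero_iff] at hv ⊢
  rw [h, sub_mulVec]
  have h1 := (LiebThm1.preservesSectors_hamiltonian (⊥ : SimpleGraph Λ) 0 1).isInSector_mulVec hv
  have h0 := (LiebThm1.preservesSectors_hamiltonian (⊥ : SimpleGraph Λ) 0 0).isInSector_mulVec hv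
  intro s hs
  rw [Pi.sub_apply, h1 s hs, h0 s hs, sub_zero]

/-- The Hubbard Hamiltonian preserves the joint sectors `(2m, S^z = 0)`. Lieb, PRL 62 (1989)
1201, proof of Theorem 1. [folklore] -/
theorem hamiltonian_mulVec_mem_szSector (t U : ℝ) (m : ℕ) {v : Fock (Orb Λ)}
    (hv : v ∈ szSector (2 * m) 0) : hamiltonian G t U *ᵥ v ∈ szSector (2 * m) 0 := by
  rw [mem_szSector_two_mul_zero_iff] at hv ⊢
  exact (LiebThm1.preservesSectors_hamiltonian G t U).isInSector_mulVec hv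

/-- **T/U states from a straight ground-energy stretch** (Hubbard model on any finite graph,
joint sector `(2m, S^z = 0)`; the tool behind the "T/U dichotomy" refinement of
`DarkPartnerExclusion` in card `integer-pencil-schur-residue`). The sector ground energy
`e(U) = minEnergyOn (hamiltonian G t U) (szSector (2m) 0)` is concave in `U`; if it satisfies the
midpoint equality `2 e(U₀) ≤ e(U₀ - η) + e(U₀ + η)` for some `η ≠ 0` (e.g. `e` affine on
`[U₀ - η, U₀ + η]`), then EVERY sector ground state `ψ` at `U₀` is (i) a sector ground state at
`U₀ - η` and at `U₀ + η`, and (ii) a joint eigenvector of the double-occupancy number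
`Σ_x n_{x↑} n_{x↓}` (eigenvalue `β = (e(U₀ + η) - e(U₀ - η)) / (2η)`) and of the pure hopping
Hamiltonian `hamiltonian G t 0` (eigenvalue `e(U₀ + η) - (U₀ + η) β`).
Bruus–Anglès d'Auriac, PRB 55 (1997) 9142, §5.2 and App. D; Tasaki (2020) §2.1. [folklore] -/
theorem hubbard_jointEigen_of_midpoint (t : ℝ) (m : ℕ) (U₀ η : ℝ) (hη : η ≠ 0)
    (hmid : 2 * (hamiltonian G t U₀).minEnergyOn (szSector (2 * m) 0) ≤
      (hamiltonian G t (U₀ - η)).minEnergyOn (szSector (2 * m) 0) +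
        (hamiltonian G t (U₀ + η)).minEnergyOn (szSector (2 * m) 0))
    {ψ : Fock (Orb Λ)} (hgs : IsGroundStateInSector (hamiltonian G t U₀) (2 * m) 0 ψ) :
    IsGroundStateInSector (hamiltonian G t (U₀ - η)) (2 * m) 0 ψ ∧
      IsGroundStateInSector (hamiltonian G t (U₀ + η)) (2 * m) 0 ψ ∧
      (∑ x : Λ, numberOp x 0 * numberOp x 1) *ᵥ ψ =
        ((((hamiltonian G t (U₀ + η)).minEnergyOn (szSector (2 * m) 0) -
            (hamiltonian G t (U₀ - η)).minEnergyOn (szSector (2 * m) 0)) / (2 * η) : ℝ) : ℂ) •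
          ψ ∧
      hamiltonian G t 0 *ᵥ ψ =
        (((hamiltonian G t (U₀ + η)).minEnergyOn (szSector (2 * m) 0) - (U₀ + η) *
            (((hamiltonian G t (U₀ + η)).minEnergyOn (szSector (2 * m) 0) -
              (hamiltonian G t (U₀ - η)).minEnergyOn (szSector (2 * m) 0)) / (2 * η)) : ℝ) :
            ℂ) • ψ := by
  obtain ⟨hψK, hψ0, hHψ⟩ := hgs
  -- (i) the endpoints, in the model's own terms
  have hsum : hamiltonian G t (U₀ - η) + hamiltonian G t (U₀ + η) =
      hamiltonian G t U₀ + hamiltonian G t U₀ := by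
    rw [hamiltonian_eq_add_smul_doublon G t (U₀ - η), hamiltonian_eq_add_smul_doublon G t (U₀ + η),
      hamiltonian_eq_add_smul_doublon G t U₀]
    have hc : ((U₀ - η : ℝ) : ℂ) + ((U₀ + η : ℝ) : ℂ) = (U₀ : ℂ) + (U₀ : ℂ) := by
      push_cast
      ring
    calc (hamiltonian G t 0 + ((U₀ - η : ℝ) : ℂ) • ∑ x : Λ, numberOp x 0 * numberOp x 1) +
          (hamiltonian G t 0 + ((U₀ + η : ℝ) : ℂ) • ∑ x : Λ, numberOp x 0 * numberOp x 1)
        = (hamiltonian G t 0 + hamiltonian G t 0) +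
            (((U₀ - η : ℝ) : ℂ) + ((U₀ + η : ℝ) : ℂ)) • ∑ x : Λ, numberOp x 0 * numberOp x 1 := by
          rw [add_smul]; abel
      _ = (hamiltonian G t 0 + hamiltonian G t 0) +
            ((U₀ : ℂ) + (U₀ : ℂ)) • ∑ x : Λ, numberOp x 0 * numberOp x 1 := by rw [hc]
      _ = (hamiltonian G t 0 + (U₀ : ℂ) • ∑ x : Λ, numberOp x 0 * numberOp x 1) +
            (hamiltonian G t 0 + (U₀ : ℂ) • ∑ x : Λ, numberOp x 0 * numberOp x 1) := by
          rw [add_smul]; abel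
  obtain ⟨hm, hp⟩ := groundState_endpoints_of_midpoint (szSector (2 * m) 0)
    (LiebThm1.hamiltonian_isHermitian G t (U₀ - η)).eq
    (LiebThm1.hamiltonian_isHermitian G t (U₀ + η)).eq
    (fun v hv => hamiltonian_mulVec_mem_szSector G t (U₀ - η) m hv)
    (fun v hv => hamiltonian_mulVec_mem_szSector G t (U₀ + η) m hv) hsum hmid hψK hHψ
  refine ⟨⟨hψK, hψ0, hm⟩, ⟨hψK, hψ0, hp⟩, ?_⟩
  -- (ii) joint eigenvector: pass to the pencil form `H(U) = H(0) + U · D`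
  rw [hamiltonian_eq_add_smul_doublon G t U₀] at hHψ hmid
  rw [hamiltonian_eq_add_smul_doublon G t (U₀ - η), hamiltonian_eq_add_smul_doublon G t (U₀ + η)]
    at hmid ⊢
  exact pencil_jointEigen_of_midpoint (szSector (2 * m) 0) (LiebThm1.hamiltonian_isHermitian G t 0).eq
    doublon_isHermitian (fun v hv => hamiltonian_mulVec_mem_szSector G t 0 m hv)
    (fun v hv => doublon_mulVec_mem_szSector m hv) U₀ η hη hmid hψK hHψ

end Hubbard

end Summit.HubbardSuperconductivity.HubbardSuperconductivity.Theorems
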